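import Summits.QuantumFields.BalabanUV.Beta.CombMixedT2EvenStoreyTwoCopies

/-!
# `BalabanUV.Beta.CombMixedT2EvenStoreyTwoTorus` — binder row D1 ∕ (C1), PART 31c: **(K2b) AT DEPTH 2 ON THE TORUS, STOREYWISE — ENTRYWISE**: for the coarse-slot-periodised
# even COMPOSITE mixed table of depth 2 (PART 31a's family `V`, any box `M = Lc²·M′`) and every torus gauge parameter `s`,
# `Σ_{u ∈ pbox M} Σ_κ tgrad M (u, inl κ) s · perZ M (dper M (V κ u)) x z (inl α) (inl γ)
#   = wM2 · ( Σ_{b₁,b₂ ∈ win β} (δ_s(root b₂) − δ_s(root b₁))·h(β;b₁,b₂)·ℓ̃(b₁;(α,x))·ℓ̃(b₂;(γ,z)) + (δ_s z − δ_s x)·Σ_{b ∈ win β} ℓ(β;b)·perZ M (dper M (symHessFFAt ρ_c Lc b)) x z (inl α) (inl γ) )`,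
# `ℓ̃(b;(α,x)) := Σ'_n ℓ(b;(α, x + M∘n))` — the TOP storey's commutator with the ROOT-SAMPLED indicator between the fine-slot-periodised transports plus the LOWER storey's finest
# commutators of the periodised level-0 Hessian bricks of the window bonds of `β = (ρ′, w)`, weighted by the level-1 linear brick; NO level-1 torus is needed

WHY (J-NOTE-14 §5; road FP g46 A-3; Engine C TIER V-A `γ = −1`).  PART 30 gave the lattice row per coarse bond; PART 31a∕b reduce the torus row to `Σ'_m Σ'_n` (right-slot period
copies × coarse-bond copies) of PART 30's two-storey word and show (31b §5) that the word at the copy `w + M′∘n` is the word at `w` read at the fluctuation pair shifted by `−M∘n` —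
so the whole torus row is `wM2 · perZ M (dper M Φ_w)` of ONE lattice kernel `Φ_w` = PART 30's right side at `w`.  This file folds: by 31b §6 the double period sum decouples into a
finite double sum; the rank-one top word `ℓ(b₁;·)·ℓ(b₂;·)` periodises to the product of the two fine-slot-periodised transports, the lower word `ℓ(β;b)·h(b;·,·)` to
`ℓ(β;b)·perZ M (dper M (symHessFFAt ρ_c Lc b))` — PART 26's `Ĥ` letter one storey down, per window bond of `β`.

WHAT (`d = 3`, centred root, weight `wM2 3 L₂ j` free; [folklore] re-indexing BY NAME; no `def`, no `def … : Prop`, nothing cited, 0 sorry):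
§7 `sum_push4 ∕ sum_push2` (finite sum exchanges); **`tsum_sum_dz_tdelta_mul_compMixedT2per_even`** (steps B–D: the lattice contraction of the family along `δ_s` =
`wM2 · Σ'_n Φ_w(x+M∘n, z′+M∘n)`); **`tsum_tsum_storeyWords_eq`** (step F: the fold, for arbitrary top∕lower coefficients); **`sum_tgrad_mul_perZ_dper_compMixedT2per_even`** (the
display above).
WHAT THIS IS NOT: not the matrix row along a gauge FUNCTION (PART 31d `CombMixedT2EvenStoreyTwoTorusRow`); not depth ≥ 3 (induction over `compMixKer_succ` with (W-lin)_m); not (J-R₂), not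
v7's display (the road's call); nothing of Bałaban's asserted, valued or discharged; 0 estimates; 0∕4 row-D1 binders (hW, hR, D1Tel, D1Rep); ROOT M‴ p325680 ∕ P5c ∕ D6 untouched;
NOT (C1), NOT (T-ID), NOT D1, NEVER «G-an2-4 closed», NOT BetaPertH, NOT continuum, NOT Clay.

HONEST DEPENDENCY (page 1, mandatory): continuum YM on T⁴ ⇐ BetaPertH ∧ nine spine estimates (0/9 proved); BetaPertH ⇐ (D1) ∧ (D4) ∧ CAP+tail;
G-an2-4 gates asym, D1 and NE2/3/4.  HONEST FRAMING (cell contract, verbatim): «discharging `BetaPertH` makes Bałaban's UV stability UNCONDITIONAL —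
a real constructive-QFT result; it is NOT the continuum limit and NOT the Clay problem.»  ABSOLUTE RULE (cell charter, verbatim): «No internally-minted
statement may enter as a cited fact. Every hypothesis is either kernel-proved in this package or a verbatim quotation of a PUBLISHED theorem with page
reference. The manuscript(s) under audit are NOT citable for their own disputed steps — they are the thing under adjudication; programme-internal
(2001/route/tribunal) claims are never citable.»  Row D1 ∕ (C1) OWNER an2 (b2b-balaban-beta-an2) gen 71, 2026-08-28.  No existing file touched.
-/

noncomputable section

open scoped BigOperators

namespace Summit.QuantumFields.BalabanUV.Beta.CombMixedT2EvenStoreyTwoTorus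

open Finset Matrix
open Literature.MathematicalPhysics.QuantumFieldTheory
open Literature.MathematicalPhysics.QuantumFieldTheory.Balaban1983to89
open Literature.MathematicalPhysics.QuantumFieldTheory.Balaban1983to89.Beta
open B4TorusKernel.MultiPeriod (translate translate_apply)
open B4Reflection242 (translate_translate)
open B6Lemma24Torus (pbox mem_pbox)
open ExpKernelCalculus (MKer shiftK)
open AffineAveraging (Site box toSite unitVec dz)
open AveragingContoursRooted (ctr ctrOff ctrOff_mem_box)
open AveragingHessianKernels (Bond Near)
open OneStepResolventKernel (Fib)
open BalabanStepW2 (M2Of wM2)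
open Summit.QuantumFields.BalabanUV.Beta.TameKernelCalculus (trK)
open Summit.QuantumFields.BalabanUV.Beta.BorderedHessian (sgnK)
open Summit.QuantumFields.BalabanUV.Beta.AxialDressingRooted (cube mem_cube one_le_of_neZero)
open Summit.QuantumFields.BalabanUV.Beta.SymAveragingHessianCounts (symLinKerAt symHessKerAt symHessFFAt symHessFFAt_inl_inl symLinKerAt_eq_zero symLinKerAt_add
  symHessKerAt_add symHessKerAt_eq_zero_left symHessKerAt_eq_zero_right)
open Summit.QuantumFields.BalabanUV.Beta.CompositeVertexKernelRec (offs near_iff_exists_offs)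
open Summit.QuantumFields.BalabanUV.Beta.CompositeOneShotJets (compMix)
open Summit.QuantumFields.BalabanUV.Beta.FP.KernelPeriodisationFib (Idx perF perF_apply perZ perZ_apply perZ_smul translate_eq_add)
open Summit.QuantumFields.BalabanUV.Beta.FP.KernelPeriodisationFibLoc (dper dper_apply)
open Summit.QuantumFields.BalabanUV.Beta.FP.TorusGaugeCovariance (tdelta tdelta_translate tgrad)
open Summit.QuantumFields.BalabanUV.Beta.FP.TorusGaugeCovariancePairing (sum_tdelta_mul wrapPt wrapPt_of_mem)
open Summit.QuantumFields.BalabanUV.Beta.FP.PeriodisedBorderIndexWard (translate_injective)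
open Summit.QuantumFields.BalabanUV.Beta.FP.PeriodisedBorderTables (translate_eq_add_smul)
open Summit.QuantumFields.BalabanUV.Beta.CombMixedT2EvenStoreyTwoPeriodised (compMixedT2per_even_periodCov compMixedT2per_even_inl_inl_eq_zero_of_not_mem_T
  compMixedT2per_even_inl_inl_eq_zero_of_not_mem_S tsum_sum_dz_mul_compMixedT2per_even_inl_inl tsum_sum_dz_mul_compMixedT2_even_inl_inl)
open Summit.QuantumFields.BalabanUV.Beta.CombMixedT2EvenStoreyTwoCopies (sum_tgrad_mul_perZ_dper_eq_tsum_of_periodCov symLinKerAt_copy symHessKerAt_top_copy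
  symLinKerAt_top_copy symHessKerAt_low_copy root_copy not_near_of_not_mem_window₂ tsum_tsum_translate_eq_sum_sum)

variable {Lc : ℕ} [NeZero Lc]

/-! ## §7 (K2b) at depth 2 on the torus, storeywise: the periodised even composite mixed bi-member along a torus pure gauge in its FINE bond -/

section Torus

variable {M M' : Fin (3 + 1) → ℕ} [∀ μ, NeZero (M μ)] [∀ μ, NeZero (M' μ)] (L₂ j : ℕ) (ρ' : Fin (3 + 1)) (w : Site (3 + 1))
  {V : Fin (3 + 1) → Site (3 + 1) → MKer (3 + 1) (Fib 3)}

omit [NeZero Lc] in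
/-- [folklore] moving a finite outer sum inside a four-fold window sum. -/
theorem sum_push4 {ι : Type*} (s : Finset ι) {L : ℕ} (G : ι → Fin (3 + 1) → Site (3 + 1) → Fin (3 + 1) → Site (3 + 1) → ℝ) :
    (∑ a ∈ s, ∑ κ₁ : Fin (3 + 1), ∑ e₁ ∈ offs L, ∑ κ₂ : Fin (3 + 1), ∑ e₂ ∈ offs L, G a κ₁ e₁ κ₂ e₂)
      = ∑ κ₁ : Fin (3 + 1), ∑ e₁ ∈ offs L, ∑ κ₂ : Fin (3 + 1), ∑ e₂ ∈ offs L, ∑ a ∈ s, G a κ₁ e₁ κ₂ e₂ :=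
  Finset.sum_comm.trans (Finset.sum_congr rfl fun _ _ => Finset.sum_comm.trans (Finset.sum_congr rfl fun _ _ =>
    Finset.sum_comm.trans (Finset.sum_congr rfl fun _ _ => Finset.sum_comm)))

omit [NeZero Lc] in
/-- [folklore] moving a finite outer sum inside a two-fold window sum. -/
theorem sum_push2 {ι : Type*} (s : Finset ι) {L : ℕ} (G : ι → Fin (3 + 1) → Site (3 + 1) → ℝ) :
    (∑ a ∈ s, ∑ κ : Fin (3 + 1), ∑ e ∈ offs L, G a κ e) = ∑ κ : Fin (3 + 1), ∑ e ∈ offs L, ∑ a ∈ s, G a κ e :=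
  Finset.sum_comm.trans (Finset.sum_congr rfl fun _ _ => Finset.sum_comm)

omit [∀ μ, NeZero (M μ)] in
/-- [folklore] **STEPS B–D — THE LATTICE CONTRACTION OF THE PERIODISED FAMILY IS THE SUM OVER PERIOD SHIFTS OF THE ORIGINAL BOND's TWO STOREY WORDS**: for every
`M`-periodic indicator `δ_s` and right site `z′`,
`Σ'_u Σ_κ (δ_s(u+e_κ) − δ_s u)·V κ u x z′ (inl α) (inl γ) = wM2 L₂ j · Σ'_n ( TOP(w; x + M∘n, z′ + M∘n) + (δ_s z′ − δ_s x)·LOW(w; x + M∘n, z′ + M∘n) )`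
(copies out of the contraction, PART 30 per copy, §5's joint period covariance with the copy index reversed). -/
theorem tsum_sum_dz_tdelta_mul_compMixedT2per_even (hM : ∀ i, M i = Lc ^ 2 * M' i)
    (hV : V = fun κ u x z a c => ∑' n : Site (3 + 1),
      ((1 / 2 : ℝ) • (M2Of 3 L₂ (compMix (ctrOff (3 + 1) Lc) Lc 2) j κ u ρ' (translate M' w n)
          + sgnK (trK (M2Of 3 L₂ (compMix (ctrOff (3 + 1) Lc) Lc 2) j κ u ρ' (translate M' w n))))) x z a c)
    (s : ↥(pbox M)) (x z' : Site (3 + 1)) (α γ : Fin (3 + 1)) :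
    (∑' u : Site (3 + 1), ∑ κ : Fin (3 + 1), dz (fun w => tdelta M w s) κ u * V κ u x z' (Sum.inl α) (Sum.inl γ))
      = wM2 3 L₂ j * ∑' n : Site (3 + 1), ((∑ κ₁ : Fin (3 + 1), ∑ e₁ ∈ offs Lc, ∑ κ₂ : Fin (3 + 1), ∑ e₂ ∈ offs Lc,
          (tdelta M ((Lc : ℤ) • ((Lc : ℤ) • w + e₂) + ctr 4 Lc) s - tdelta M ((Lc : ℤ) • ((Lc : ℤ) • w + e₁) + ctr 4 Lc) s)
            * symHessKerAt (ctr 4 Lc) Lc ρ' w (κ₁, (Lc : ℤ) • w + e₁) (κ₂, (Lc : ℤ) • w + e₂)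
            * symLinKerAt (ctr 4 Lc) Lc κ₁ ((Lc : ℤ) • w + e₁) (α, translate M x n) * symLinKerAt (ctr 4 Lc) Lc κ₂ ((Lc : ℤ) • w + e₂) (γ, translate M z' n))
        + (tdelta M z' s - tdelta M x s) * ∑ κ : Fin (3 + 1), ∑ e ∈ offs Lc,
            symLinKerAt (ctr 4 Lc) Lc ρ' w (κ, (Lc : ℤ) • w + e)
              * symHessKerAt (ctr 4 Lc) Lc κ ((Lc : ℤ) • w + e) (α, translate M x n) (γ, translate M z' n)) := by
  rw [tsum_sum_dz_mul_compMixedT2per_even_inl_inl L₂ j ρ' w hV,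
    tsum_congr fun n => tsum_sum_dz_mul_compMixedT2_even_inl_inl (Lc := Lc) L₂ j (fun w => tdelta M w s) ρ' (translate M' w n) x z' α γ, tsum_mul_left]
  -- copy `n` of the coarse bond ↔ fluctuation pair shifted by `−M∘n`; then reverse the copy index (`congrArg`, not `congr`: no `rfl` attempt on the big sums)
  refine congrArg (fun t : ℝ => wM2 3 L₂ j * t) (Eq.trans (tsum_congr fun n => ?_) ((Equiv.neg (Site (3 + 1))).tsum_eq _))
  simp only [Equiv.neg_apply, symLinKerAt_copy w n hM, symHessKerAt_top_copy, symLinKerAt_top_copy, symHessKerAt_low_copy w n hM, root_copy w n hM,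
    tdelta_translate]

omit [∀ μ, NeZero (M' μ)] in
/-- [folklore] **STEP F — FOLDING THE TWO STOREY WORDS OVER THE DOUBLE PERIOD SUM**: for any top coefficients `C e₁ e₂`, lower coefficient `c` and `ff` entry,
`Σ'_m Σ'_n ( Σ⁴ C·h(ρ′,w;b₁,b₂)·ℓ(b₁;(α,x+M∘n))·ℓ(b₂;(γ,z+M∘m+M∘n)) + c·Σ² ℓ(ρ′,w;b)·h(b;(α,x+M∘n),(γ,z+M∘m+M∘n)) )
 = Σ⁴ C·h(ρ′,w;b₁,b₂)·(Σ'_n ℓ(b₁;(α,x+M∘n)))·(Σ'_n ℓ(b₂;(γ,z+M∘n))) + c·Σ² ℓ(ρ′,w;b)·perZ M (dper M (symHessFFAt ρ_c Lc κ (Lc•w+e))) x z (inl α) (inl γ)`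
— every piece is a function of the two fluctuation sites supported in the fine window of the coarse bond, so §6 decouples the double period sum; then finite-sum algebra. -/
theorem tsum_tsum_storeyWords_eq (C : Site (3 + 1) → Site (3 + 1) → ℝ) (c : ℝ) (x z : Site (3 + 1)) (α γ : Fin (3 + 1)) :
    (∑' m : Site (3 + 1), ∑' n : Site (3 + 1), ((∑ κ₁ : Fin (3 + 1), ∑ e₁ ∈ offs Lc, ∑ κ₂ : Fin (3 + 1), ∑ e₂ ∈ offs Lc,
          C e₁ e₂ * symHessKerAt (ctr 4 Lc) Lc ρ' w (κ₁, (Lc : ℤ) • w + e₁) (κ₂, (Lc : ℤ) • w + e₂)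
            * symLinKerAt (ctr 4 Lc) Lc κ₁ ((Lc : ℤ) • w + e₁) (α, translate M x n)
            * symLinKerAt (ctr 4 Lc) Lc κ₂ ((Lc : ℤ) • w + e₂) (γ, translate M (translate M z m) n))
        + c * ∑ κ : Fin (3 + 1), ∑ e ∈ offs Lc,
            symLinKerAt (ctr 4 Lc) Lc ρ' w (κ, (Lc : ℤ) • w + e)
              * symHessKerAt (ctr 4 Lc) Lc κ ((Lc : ℤ) • w + e) (α, translate M x n) (γ, translate M (translate M z m) n)))
      = (∑ κ₁ : Fin (3 + 1), ∑ e₁ ∈ offs Lc, ∑ κ₂ : Fin (3 + 1), ∑ e₂ ∈ offs Lc,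
          C e₁ e₂ * symHessKerAt (ctr 4 Lc) Lc ρ' w (κ₁, (Lc : ℤ) • w + e₁) (κ₂, (Lc : ℤ) • w + e₂)
            * (∑' n : Site (3 + 1), symLinKerAt (ctr 4 Lc) Lc κ₁ ((Lc : ℤ) • w + e₁) (α, translate M x n))
            * (∑' n : Site (3 + 1), symLinKerAt (ctr 4 Lc) Lc κ₂ ((Lc : ℤ) • w + e₂) (γ, translate M z n)))
        + c * ∑ κ : Fin (3 + 1), ∑ e ∈ offs Lc,
            symLinKerAt (ctr 4 Lc) Lc ρ' w (κ, (Lc : ℤ) • w + e) * perZ M (dper M (symHessFFAt (ctr 4 Lc) Lc κ ((Lc : ℤ) • w + e))) x z (Sum.inl α) (Sum.inl γ) := by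
  have hLc : 1 ≤ Lc := one_le_of_neZero Lc
  -- the fine window of the coarse bond and the period indices meeting it
  obtain ⟨Wf, hWf⟩ : ∃ Wf : Finset (Site (3 + 1)), Wf = (offs Lc).biUnion fun e => (offs Lc).image fun e' => (Lc : ℤ) • ((Lc : ℤ) • w + e) + e' := ⟨_, rfl⟩
  obtain ⟨Nx, hNx⟩ : ∃ Nx : Finset (Site (3 + 1)), ∀ n ∉ Nx, translate M x n ∉ Wf :=
    ⟨Wf.preimage (fun n => translate M x n) (translate_injective (M := M) x).injOn, fun n hn h => hn (Finset.mem_preimage.2 h)⟩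
  obtain ⟨Nz, hNz⟩ : ∃ Nz : Finset (Site (3 + 1)), ∀ k ∉ Nz, translate M z k ∉ Wf :=
    ⟨Wf.preimage (fun k => translate M z k) (translate_injective (M := M) z).injOn, fun k hk h => hk (Finset.mem_preimage.2 h)⟩
  have hℓ0 : ∀ (κ₁ : Fin (3 + 1)) (e₁ : Site (3 + 1)), e₁ ∈ offs Lc → ∀ (ξ : Fin (3 + 1)) (x' : Site (3 + 1)), x' ∉ Wf →
      symLinKerAt (ctr 4 Lc) Lc κ₁ ((Lc : ℤ) • w + e₁) (ξ, x') = 0 := fun κ₁ e₁ he₁ ξ x' hx' => by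
    subst hWf
    rw [show ctr 4 Lc = toSite (ctrOff 4 Lc) from rfl]
    exact symLinKerAt_eq_zero (ctrOff_mem_box hLc) (f := (ξ, x')) (not_near_of_not_mem_window₂ hx' he₁)
  have hhL : ∀ (κ : Fin (3 + 1)) (e : Site (3 + 1)), e ∈ offs Lc → ∀ (ξ : Fin (3 + 1)) (x' : Site (3 + 1)), x' ∉ Wf → ∀ f' : Bond (3 + 1),
      symHessKerAt (ctr 4 Lc) Lc κ ((Lc : ℤ) • w + e) (ξ, x') f' = 0 := fun κ e he ξ x' hx' f' => by
    subst hWf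
    rw [show ctr 4 Lc = toSite (ctrOff 4 Lc) from rfl]
    exact symHessKerAt_eq_zero_left (ctrOff_mem_box hLc) (f := (ξ, x')) (not_near_of_not_mem_window₂ hx' he) f'
  have hhR : ∀ (κ : Fin (3 + 1)) (e : Site (3 + 1)), e ∈ offs Lc → ∀ (f : Bond (3 + 1)) (ξ' : Fin (3 + 1)) (z' : Site (3 + 1)), z' ∉ Wf →
      symHessKerAt (ctr 4 Lc) Lc κ ((Lc : ℤ) • w + e) f (ξ', z') = 0 := fun κ e he f ξ' z' hz' => by
    subst hWf
    rw [show ctr 4 Lc = toSite (ctrOff 4 Lc) from rfl]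
    exact symHessKerAt_eq_zero_right (ctrOff_mem_box hLc) f (f' := (ξ', z')) (not_near_of_not_mem_window₂ hz' he)
  -- the double period sum of the two storey words decouples into a finite double sum
  rw [tsum_tsum_translate_eq_sum_sum M (fun x' z' => (∑ κ₁ : Fin (3 + 1), ∑ e₁ ∈ offs Lc, ∑ κ₂ : Fin (3 + 1), ∑ e₂ ∈ offs Lc,
          C e₁ e₂ * symHessKerAt (ctr 4 Lc) Lc ρ' w (κ₁, (Lc : ℤ) • w + e₁) (κ₂, (Lc : ℤ) • w + e₂)
            * symLinKerAt (ctr 4 Lc) Lc κ₁ ((Lc : ℤ) • w + e₁) (α, x') * symLinKerAt (ctr 4 Lc) Lc κ₂ ((Lc : ℤ) • w + e₂) (γ, z'))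
        + c * ∑ κ : Fin (3 + 1), ∑ e ∈ offs Lc,
            symLinKerAt (ctr 4 Lc) Lc ρ' w (κ, (Lc : ℤ) • w + e) * symHessKerAt (ctr 4 Lc) Lc κ ((Lc : ℤ) • w + e) (α, x') (γ, z')) x z Nx Nz
      (fun n hn z' => by
        rw [Finset.sum_eq_zero fun κ₁ _ => Finset.sum_eq_zero fun e₁ he₁ => Finset.sum_eq_zero fun κ₂ _ => Finset.sum_eq_zero fun e₂ _ => by
            rw [hℓ0 κ₁ e₁ he₁ α _ (hNx n hn), mul_zero, zero_mul],
          Finset.sum_eq_zero fun κ _ => Finset.sum_eq_zero fun e he => by rw [hhL κ e he α _ (hNx n hn), mul_zero], mul_zero, add_zero])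
      (fun k hk x' => by
        rw [Finset.sum_eq_zero fun κ₁ _ => Finset.sum_eq_zero fun e₁ _ => Finset.sum_eq_zero fun κ₂ _ => Finset.sum_eq_zero fun e₂ he₂ => by
            rw [hℓ0 κ₂ e₂ he₂ γ _ (hNz k hk), mul_zero],
          Finset.sum_eq_zero fun κ _ => Finset.sum_eq_zero fun e he => by rw [hhR κ e he _ γ _ (hNz k hk), mul_zero], mul_zero, add_zero])]
  -- the periodised transports and the periodised lower bricks are finite sums over the same period indices
  have hℓx : ∀ (κ₁ : Fin (3 + 1)) (e₁ : Site (3 + 1)), e₁ ∈ offs Lc →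
      (∑' n : Site (3 + 1), symLinKerAt (ctr 4 Lc) Lc κ₁ ((Lc : ℤ) • w + e₁) (α, translate M x n))
        = ∑ n ∈ Nx, symLinKerAt (ctr 4 Lc) Lc κ₁ ((Lc : ℤ) • w + e₁) (α, translate M x n) := fun κ₁ e₁ he₁ =>
    tsum_eq_sum fun n hn => hℓ0 κ₁ e₁ he₁ α _ (hNx n hn)
  have hℓz : ∀ (κ₂ : Fin (3 + 1)) (e₂ : Site (3 + 1)), e₂ ∈ offs Lc →
      (∑' n : Site (3 + 1), symLinKerAt (ctr 4 Lc) Lc κ₂ ((Lc : ℤ) • w + e₂) (γ, translate M z n))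
        = ∑ k ∈ Nz, symLinKerAt (ctr 4 Lc) Lc κ₂ ((Lc : ℤ) • w + e₂) (γ, translate M z k) := fun κ₂ e₂ he₂ =>
    tsum_eq_sum fun k hk => hℓ0 κ₂ e₂ he₂ γ _ (hNz k hk)
  have hH : ∀ (κ : Fin (3 + 1)) (e : Site (3 + 1)), e ∈ offs Lc →
      perZ M (dper M (symHessFFAt (ctr 4 Lc) Lc κ ((Lc : ℤ) • w + e))) x z (Sum.inl α) (Sum.inl γ)
        = ∑ n ∈ Nx, ∑ k ∈ Nz, symHessKerAt (ctr 4 Lc) Lc κ ((Lc : ℤ) • w + e) (α, translate M x n) (γ, translate M z k) := fun κ e he => by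
    simp only [perZ_apply, dper_apply, symHessFFAt_inl_inl]
    exact tsum_tsum_translate_eq_sum_sum M (fun x' z' => symHessKerAt (ctr 4 Lc) Lc κ ((Lc : ℤ) • w + e) (α, x') (γ, z')) x z Nx Nz
      (fun n hn z' => hhL κ e he α _ (hNx n hn) _) (fun k hk x' => hhR κ e he _ γ _ (hNz k hk))
  -- fold each storey back: the finite period sums ARE the periodised transports ∕ the periodised lower bricks
  have eTop : (∑ n ∈ Nx, ∑ k ∈ Nz, ∑ κ₁ : Fin (3 + 1), ∑ e₁ ∈ offs Lc, ∑ κ₂ : Fin (3 + 1), ∑ e₂ ∈ offs Lc,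
          C e₁ e₂ * symHessKerAt (ctr 4 Lc) Lc ρ' w (κ₁, (Lc : ℤ) • w + e₁) (κ₂, (Lc : ℤ) • w + e₂)
            * symLinKerAt (ctr 4 Lc) Lc κ₁ ((Lc : ℤ) • w + e₁) (α, translate M x n) * symLinKerAt (ctr 4 Lc) Lc κ₂ ((Lc : ℤ) • w + e₂) (γ, translate M z k))
      = ∑ κ₁ : Fin (3 + 1), ∑ e₁ ∈ offs Lc, ∑ κ₂ : Fin (3 + 1), ∑ e₂ ∈ offs Lc,
          C e₁ e₂ * symHessKerAt (ctr 4 Lc) Lc ρ' w (κ₁, (Lc : ℤ) • w + e₁) (κ₂, (Lc : ℤ) • w + e₂)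
            * (∑' n : Site (3 + 1), symLinKerAt (ctr 4 Lc) Lc κ₁ ((Lc : ℤ) • w + e₁) (α, translate M x n))
            * (∑' n : Site (3 + 1), symLinKerAt (ctr 4 Lc) Lc κ₂ ((Lc : ℤ) • w + e₂) (γ, translate M z n)) := by
    rw [Finset.sum_congr rfl fun n _ => sum_push4 Nz _, sum_push4 Nx]
    refine Finset.sum_congr rfl fun κ₁ _ => Finset.sum_congr rfl fun e₁ he₁ => Finset.sum_congr rfl fun κ₂ _ => Finset.sum_congr rfl fun e₂ he₂ => ?_
    rw [hℓx κ₁ e₁ he₁, hℓz κ₂ e₂ he₂, mul_assoc _ (∑ n ∈ Nx, _) (∑ k ∈ Nz, _), Finset.sum_mul_sum, Finset.mul_sum]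
    refine Finset.sum_congr rfl fun n _ => ?_
    rw [Finset.mul_sum]
    exact Finset.sum_congr rfl fun k _ => by ring
  have eLow : (∑ n ∈ Nx, ∑ k ∈ Nz, ∑ κ : Fin (3 + 1), ∑ e ∈ offs Lc,
          symLinKerAt (ctr 4 Lc) Lc ρ' w (κ, (Lc : ℤ) • w + e) * symHessKerAt (ctr 4 Lc) Lc κ ((Lc : ℤ) • w + e) (α, translate M x n) (γ, translate M z k))
      = ∑ κ : Fin (3 + 1), ∑ e ∈ offs Lc,
          symLinKerAt (ctr 4 Lc) Lc ρ' w (κ, (Lc : ℤ) • w + e) * perZ M (dper M (symHessFFAt (ctr 4 Lc) Lc κ ((Lc : ℤ) • w + e))) x z (Sum.inl α) (Sum.inl γ) := by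
    rw [Finset.sum_congr rfl fun n _ => sum_push2 Nz _, sum_push2 Nx]
    refine Finset.sum_congr rfl fun κ _ => Finset.sum_congr rfl fun e he => ?_
    rw [hH κ e he, Finset.mul_sum]
    exact Finset.sum_congr rfl fun n _ => by rw [Finset.mul_sum]
  rw [← eTop, ← eLow]
  simp only [Finset.sum_add_distrib, Finset.mul_sum]

/-- [folklore] **`sum_tgrad_mul_perZ_dper_compMixedT2per_even` — ENTRYWISE, ANY BOX `M = Lc²·M′`**: for the coarse-slot-periodised even COMPOSITE mixed bi-family of depth 2
`V κ u := Σ'_n M2ᵉ κ u ρ′ (w + M′∘n)` (`M2ᵉ = ½•(M2Of L₂ (compMix ρ_c Lc 2) j + sgnK∘trK)`), every torus gauge parameter `s` and `ff` entry,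
`Σ_{u ∈ pbox M} Σ_κ tgrad M (u, inl κ) s · perZ M (dper M (V κ u)) x z (inl α) (inl γ)
 = wM2 L₂ j · ( Σ_{κ₁e₁κ₂e₂} (δ_s(Lc•(Lc•w+e₂)+ρ_c) − δ_s(Lc•(Lc•w+e₁)+ρ_c))·h(ρ′,w;b₁,b₂)·(Σ'_n ℓ(b₁;(α,x+M∘n)))·(Σ'_n ℓ(b₂;(γ,z+M∘n)))
   + (δ_s z − δ_s x)·Σ_{κ,e} ℓ(ρ′,w;b)·perZ M (dper M (symHessFFAt ρ_c Lc κ (Lc•w+e))) x z (inl α) (inl γ) )` (`b = (κ, Lc•w+e)`, `δ_s := tdelta M · s`):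
the TOP storey's commutator with the ROOT-SAMPLED indicator between the fine-slot-periodised transports, plus the LOWER storey's finest commutators of the periodised level-0
Hessian bricks of the window bonds weighted by the level-1 linear brick — PART 30 copy by copy, folded by joint period covariance. -/
theorem sum_tgrad_mul_perZ_dper_compMixedT2per_even (hM : ∀ i, M i = Lc ^ 2 * M' i)
    (hV : V = fun κ u x z a c => ∑' n : Site (3 + 1),
      ((1 / 2 : ℝ) • (M2Of 3 L₂ (compMix (ctrOff (3 + 1) Lc) Lc 2) j κ u ρ' (translate M' w n)
          + sgnK (trK (M2Of 3 L₂ (compMix (ctrOff (3 + 1) Lc) Lc 2) j κ u ρ' (translate M' w n))))) x z a c)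
    (s : ↥(pbox M)) (x z : Site (3 + 1)) (α γ : Fin (3 + 1)) :
    ∑ u : ↥(pbox M), ∑ κ : Fin (3 + 1), tgrad M (u, Sum.inl κ) s * perZ M (dper M (V κ (u : Site (3 + 1)))) x z (Sum.inl α) (Sum.inl γ)
      = wM2 3 L₂ j * ((∑ κ₁ : Fin (3 + 1), ∑ e₁ ∈ offs Lc, ∑ κ₂ : Fin (3 + 1), ∑ e₂ ∈ offs Lc,
          (tdelta M ((Lc : ℤ) • ((Lc : ℤ) • w + e₂) + ctr 4 Lc) s - tdelta M ((Lc : ℤ) • ((Lc : ℤ) • w + e₁) + ctr 4 Lc) s)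
            * symHessKerAt (ctr 4 Lc) Lc ρ' w (κ₁, (Lc : ℤ) • w + e₁) (κ₂, (Lc : ℤ) • w + e₂)
            * (∑' n : Site (3 + 1), symLinKerAt (ctr 4 Lc) Lc κ₁ ((Lc : ℤ) • w + e₁) (α, translate M x n))
            * (∑' n : Site (3 + 1), symLinKerAt (ctr 4 Lc) Lc κ₂ ((Lc : ℤ) • w + e₂) (γ, translate M z n)))
        + (tdelta M z s - tdelta M x s) * ∑ κ : Fin (3 + 1), ∑ e ∈ offs Lc,
            symLinKerAt (ctr 4 Lc) Lc ρ' w (κ, (Lc : ℤ) • w + e) * perZ M (dper M (symHessFFAt (ctr 4 Lc) Lc κ ((Lc : ℤ) • w + e))) x z (Sum.inl α) (Sum.inl γ)) := by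
  -- Step A (the engine's first half): the torus contraction is the lattice contraction with the periodic indicator, periodised in the right slot
  rw [sum_tgrad_mul_perZ_dper_eq_tsum_of_periodCov V
      (fun x => (Fintype.piFinset fun _ : Fin (3 + 1) => Finset.Icc (-(CompositeVertexKernelRec.wid Lc 2 : ℤ)) (CompositeVertexKernelRec.wid Lc 2 : ℤ)).image (fun v => x - v))
      (fun x => (Fintype.piFinset fun _ : Fin (3 + 1) => Finset.Icc (-(CompositeVertexKernelRec.wid Lc 2 : ℤ)) (CompositeVertexKernelRec.wid Lc 2 : ℤ)).image (fun v => x - v))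
      (Sum.inl α) (Sum.inl γ) (compMixedT2per_even_periodCov L₂ j ρ' w hM hV)
      (fun κ u x => compMixedT2per_even_inl_inl_eq_zero_of_not_mem_S L₂ j ρ' w hV κ u x α γ)
      (fun κ x z => compMixedT2per_even_inl_inl_eq_zero_of_not_mem_T L₂ j ρ' w hV κ x z α γ) s x z,
    -- Steps B–D under the right-slot period sum
    tsum_congr fun m => tsum_sum_dz_tdelta_mul_compMixedT2per_even L₂ j ρ' w hM hV s x (translate M z m) α γ, tsum_mul_left]
  refine congrArg (fun t : ℝ => wM2 3 L₂ j * t) ?_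
  simp only [tdelta_translate]
  -- Step F
  exact tsum_tsum_storeyWords_eq ρ' w
    (fun e₁ e₂ => tdelta M ((Lc : ℤ) • ((Lc : ℤ) • w + e₂) + ctr 4 Lc) s - tdelta M ((Lc : ℤ) • ((Lc : ℤ) • w + e₁) + ctr 4 Lc) s)
    (tdelta M z s - tdelta M x s) x z α γ

end Torus

end Summit.QuantumFields.BalabanUV.Beta.CombMixedT2EvenStoreyTwoTorus

end
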